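import Literature.Computability.QuantumComplexity.JonesReduction
import Literature.Computability.QuantumComplexity.Lemma24SignHard
import Literature.Computability.QuantumComplexity.JonesInBQPHolds
import HarnessLib

/-!
# `PromiseBQP`-hardness of the Jones polynomial at `e^{2πi/5}`: the discharge

Topic `Literature/Computability/QuantumComplexity`; sibling of `JonesInBQP.lean` and
`JonesReduction.lean`. The discharge (D-0014) of the named fact `flw_jonesApproxProblem_hard` of
`JonesInBQP.lean` — D. Aharonov, I. Arad, *The BQP-hardness of approximating the Jones polynomial*,
New J. Phys. 13 (2011) 035019 (= arXiv:quant-ph/0605181), Thm. 3.1 at `k = 5` (originally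
M. Freedman, M. Larsen, Z. Wang, Comm. Math. Phys. 227 (2002)): every `PromiseBQP` problem
Karp-reduces in polynomial time to the approximation of the plat-closure Jones polynomial at the
fifth root of unity (`jonesApproxProblem`). It is the composition of

* the Karp reduction QSIM over `{H, Z, CZ, CCZ}` `≤ₚ` `jonesApproxProblem`
  (`qSimSign_polyTimeReducible_jonesApprox`, `JonesReduction.lean`: path-model encoding at `k = 5`,
  four strands per qubit, exact `ℤ[φ, ζ₅, √τ]` arithmetic, density of the one-qubit and gadget braid
  groups, numerics-free polynomial-time braid compiler), packaged as
  `flw_jonesApproxProblem_hard_of_sign_hard`, and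
* the `PromiseBQP`-hardness of QSIM over the sign basis, Aaronson–Ambainis Lemma 24
  (`AaronsonAmbainis2018_lemma24_sign_hard_holds`, `Lemma24SignHard.lean`),

by transitivity of Karp reductions of promise problems (Goldreich 2006, Def. 1.4). Together with the
membership half (`ajl_jonesApproxProblem_mem_PromiseBQP_holds`, `JonesInBQPHolds.lean`; Aharonov–Jones–Landau
2009) this gives the unconditional `PromiseBQP`-completeness `jonesApproxProblem_PromiseBQP_complete`
(Aharonov–Arad 2011, Thm. 1.1 at `k = 5`).

## References

* D. Aharonov, I. Arad, *The BQP-hardness of approximating the Jones polynomial*, New J. Phys. 13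
  (2011) 035019; arXiv:quant-ph/0605181, Thm. 1.1, Thm. 3.1 [AharonovArad2011].
* M. Freedman, M. Larsen, Z. Wang, *A modular functor which is universal for quantum computation*,
  Comm. Math. Phys. 227 (2002) 605–622 [FreedmanLarsenWang2002].
* S. Aaronson, A. Ambainis, *Forrelation*, SIAM J. Comput. 47 (2018), §6, Lemma 24 [AaronsonAmbainis2018].
* D. Aharonov, V. Jones, Z. Landau, *A polynomial quantum algorithm for approximating the Jones
  polynomial*, Algorithmica 55 (2009) 395–421, Thm. 1.2 [AharonovJonesLandau2009].
* O. Goldreich, *On promise problems: a survey*, 2006, Def. 1.4 [Goldreich2006].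
-/

namespace Literature.Computability.QuantumComplexity

open Literature.Computability.Complexity Cryptography

/-- **Aharonov–Arad (2011), Thm. 3.1 at `k = 5` (Freedman–Larsen–Wang): approximating the
plat-closure Jones polynomial at `e^{2πi/5}` to the AJL normalisation is `PromiseBQP`-hard under Karp
reductions** — discharge of the named fact `flw_jonesApproxProblem_hard` (`JonesInBQP.lean`), from the
Karp reduction `qSimSign_polyTimeReducible_jonesApprox` and the `PromiseBQP`-hardness of QSIM over the
sign basis (`AaronsonAmbainis2018_lemma24_sign_hard_holds`).
[cite: AharonovArad2011, Thm. 3.1] [cite: FreedmanLarsenWang2002, main theorem] [cite: AaronsonAmbainis2018, §6 Lemma 24] -/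
theorem flw_jonesApproxProblem_hard_holds : flw_jonesApproxProblem_hard :=
  flw_jonesApproxProblem_hard_of_sign_hard AaronsonAmbainis2018_lemma24_sign_hard_holds

/-- The hardness half in applied form: every `PromiseBQP` problem Karp-reduces to the Jones
approximation problem at `e^{2πi/5}`. [cite: AharonovArad2011, Thm. 3.1] -/
theorem polyTimeReducible_jonesApprox_of_mem_PromiseBQP (Q : PromiseProblem) (hQ : Q ∈ PromiseBQP) :
    Q.PolyTimeReducible jonesApproxProblem :=
  flw_jonesApproxProblem_hard_holds Q hQ

/-- **`PromiseBQP`-completeness of the Jones approximation at `e^{2πi/5}` (Aharonov–Arad Thm. 1.1 at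
`k = 5`; AJL membership + FLW hardness), unconditionally**: both named facts of `JonesInBQP.lean` are
discharged (`ajl_jonesApproxProblem_mem_PromiseBQP_holds`, `flw_jonesApproxProblem_hard_holds`).
[cite: AharonovArad2011, Thm. 1.1] [cite: AharonovJonesLandau2009, Thm. 1.2] -/
theorem jonesApproxProblem_PromiseBQP_complete :
    jonesApproxProblem ∈ PromiseBQP ∧ ∀ Q ∈ PromiseBQP, Q.PolyTimeReducible jonesApproxProblem :=
  jonesApproxProblem_complete ajl_jonesApproxProblem_mem_PromiseBQP_holds flw_jonesApproxProblem_hard_holds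

end Literature.Computability.QuantumComplexity
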